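import Summits.BirchSwinnertonDyer.Rank1Residual.P2.KrizLiTwoFortyThreeCurve
import Literature.NumberTheory.EllipticCurves.KrizLi2019.Table1Row243a1
import Literature.NumberTheory.EllipticCurves.RationalPointInfiniteOrderCriteria
import HarnessLib

/-!
# Cell `bsd-print-cf2` (D-0131 (2) PRINT TIER, leaf CornerF @ `p = 2`), prover p3 — the BY-NAME SLICE of
# the inert type cut by the Kriz–Li 2019 quadratic-twist family of `243a1` (`= x³ + y³ = 9`)

HONEST FRAMING. The leaf `Summit.BirchSwinnertonDyer.WAllCornerFTwo` (every CM `E/ℚ` of analytic rank one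
satisfies Miller's `BSD(E,2)`) and the crux `InertTwoRankOneOfFacts` of route PrintCf2 (its inert type:
`K_CM ∈ {ℚ(√−3), ℚ(√−11), …}`) are OPEN AS CLASSES; nothing class-wide is closed here. This file proves, for
ONE explicit infinite family inside the Eisenstein-field half of the inert type — the globally minimal
models of the quadratic twists `243a1^{(d)}` and `243a1^{(−23d)}`, `d ∈ 𝒩` (Kriz–Li Def 4.1 at
`E = 243a1`, `K = ℚ(√−23)`), `χ_d(−N) = 1` — that `BSD(W,2)` holds, GRANTED BY NAME six published facts:
Kriz–Li 2019 Thm 5.1 (2) (`KrizLi2019.thm112_bsdTwo_twist`, in the crux bundle 𝔅_inert) and Thm 4.3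
(`KrizLi2019.thm33_rank_twist`), the Table-1 row of `243a1` (`KrizLi2019.table1_row243a1`, typed by the
cell's literature seat: Assumption (★) over `ℚ(√−23)` — a TABLE entry, re-verified numerically twice,
jobs j282198 / j282381), Creutz–Miller 2012 / Miller–Stoll 2013 (`bsdTriple_of_analyticRank_le_one_of_conductor_lt`:
full BSD for `r_an ≤ 1`, `N < 5000` — gives `BSD(243a1, 2)`), Burungale–Flach 2024
(`bsdTriple_of_hasCM_of_L_one_ne_zero`, in 𝔅_inert — gives `BSD(243a1^{(−23)}, 2)`, the rank-zero CM twin of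
conductor `128547` that the paper leaves to "numerical verification", and `r_an(243a1) ≠ 0`) and modularity
(`hasEntireLFunction_rat`, in 𝔅_inert). Everything else is IN THE KERNEL (file
`P2/KrizLiTwoFortyThreeCurve.lean` and §7 here): `E(ℚ)[2] = 0`, the Heegner hypothesis, `2` split in `K`,
`c₂(E) = 1`, good reduction at `2`, `N ∣ 243`, `rank_ℤ E(ℚ) ≥ 1` (the point `(73/36, −703/216)`), hence
`r_an(243a1) = 1` exactly (Thm 4.3 gives `≤ 1`), the membership `d ∈ 𝒩` from explicit congruences, and
the transport itself (sub-lane «bsd-p2»'s consumer `P2.bsdp_two_twists_of_krizLi`). Also recorded: the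
finite printed sub-slice "conductor `< 5000`" of the whole leaf (Creutz–Miller alone).

Beyond print: the family theorem is an ASSEMBLY of printed theorems (Kriz–Li print `BSD(2)` for the
twists of the 23 Table-1 curves with odd `c₂` modulo numerical verification of the two bases; for the CM
curve `243a1` the rank-zero base is Burungale–Flach 2024) — YES as an assembly, NO as a method. For the
CUBE-SUM curves `x³ + y³ = n` off this family NOTHING is in print at `ℓ = 2` (Cai–Shu–Tian 2017 excludes
`ℓ ∣ 2p`; Kezuka–Li 2020 is `Ш[2]` only); the `243a1^{(d)}` are the `j = 0` curves `y² = x³ − 48d³`.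

References: [KrizLi2019] Thm 5.1 (2) (VoR p. 30), Thm 4.3 (p. 28), Def 4.1 (p. 27), Rem 5.2 (p. 31), §6
Example 6.2, Table 1 (row 243a1: `243a1 | −23 | 1 | ✓`, arXiv v3 `Congruence.tex` l. 1011), Rem 6.3;
[CreutzMiller2012] Thm 1.1; [Miller2011LMS] Thm 1.2, Def 1.1; [MillerStoll2012] Thm 9.1;
[BurungaleFlach2024] Thm 1.1 + Cor 2; [Cremona1997] Table 1 (243a1); [SilvermanAEC2009] VII.3.4;
[DasguptaVoight2018] §1 (`E₉ = 243a1`); tree files cited inline.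
-/

noncomputable section

open scoped Classical

open WeierstrassCurve NumberField Literature.NumberTheory.EllipticCurves
  Literature.NumberTheory.EllipticCurves.Rank1Residual
  Literature.NumberTheory.EllipticCurves.ModularForms
  Summit.BirchSwinnertonDyer.Rank1Residual

set_option autoImplicit false

namespace Summit.BirchSwinnertonDyer.Rank1Residual.P2


/-! ## §7 The base pair: `BSD(243a1, 2)` (conductor `< 5000`) and `BSD(243a1^{(−23)}, 2)` (CM, rank `0`) -/

/-- **`BSD(E, 2)` for every `E/ℚ` of analytic rank `≤ 1` and conductor `< 5000`** — Creutz–Miller 2012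
Thm 1.1 / Miller 2011 Thm 1.2 / Miller–Stoll 2013 Thm 9.1 BY NAME (`hS31`, tree
`bsdTriple_of_analyticRank_le_one_of_conductor_lt`), read at `p = 2` (Miller's `BSD(E,2)` from
RANK ∧ SHAFIN ∧ LEAD, tree `forall_bsdp_of_bsdTriple'`). This is the finite PRINTED sub-slice of every
crux of route PrintCf2 (e.g. `27a`, `36a`, `243a`, `121b`, the small twists of `49a`): Kriz–Li's
Remark 5.2 "BSD(2) for a single elliptic curve (of small conductor) can be proved by numerical
calculation when `r ≤ 1` (see [51] for curves of conductor at most 5000)".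
[cite: CreutzMiller2012, Thm. 1.1] [cite: Miller2011LMS, Thm. 1.2] [cite: KrizLi2019, Rem. 5.2 (FMS)] -/
theorem bsdp_two_of_analyticRank_le_one_of_conductor_lt_5000
    (hS31 : bsdTriple_of_analyticRank_le_one_of_conductor_lt) (W : WeierstrassCurve ℚ) [W.IsElliptic]
    [W.IsGloballyMinimal] (hr : W.analyticRank ≤ 1) (hN : W.conductorNorm ℤ < 5000) : BSDp W 2 :=
  forall_bsdp_of_bsdTriple' W (hS31 W hr hN) 2 Nat.prime_two

/-- **The finite printed sub-slice of the leaf `WAllCornerFTwo`, in LEAF SHAPE**: every globally minimal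
CM curve of analytic rank one AND CONDUCTOR `< 5000` satisfies `BSD(E,2)`, granted Creutz–Miller /
Miller–Stoll BY NAME (`hS31`); the CM hypothesis is not used. Beyond print: NO.
[cite: CreutzMiller2012, Thm. 1.1] [cite: MillerStoll2012, Thm. 9.1] -/
theorem cornerFTwo_of_conductor_lt_5000 (hS31 : bsdTriple_of_analyticRank_le_one_of_conductor_lt) :
    ∀ (W : WeierstrassCurve ℚ) [W.IsElliptic] [W.IsGloballyMinimal], W.HasCM → W.analyticRank = 1 →
      W.conductorNorm ℤ < 5000 → BSDp W 2 :=
  fun W _ _ _ hr hN => bsdp_two_of_analyticRank_le_one_of_conductor_lt_5000 hS31 W hr.le hN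

/-- **`BSD(243a1, 2)`** — the CERTIFIED BASE of the Kriz–Li transport: `N(243a1) ∣ 243 < 5000` and
`ord_{s=1} L(243a1, s) = 1` (the printed rank entry of Table 1, `hr`), so Creutz–Miller / Miller–Stoll
(`hS31`) applies. [cite: CreutzMiller2012, Thm. 1.1] [cite: KrizLi2019, Rem. 5.2 and Table 1 (row 243a1)] -/
theorem bsdp_two_curve243a1 (hS31 : bsdTriple_of_analyticRank_le_one_of_conductor_lt)
    (hr : curve243a1.analyticRank = 1) : BSDp curve243a1 2 :=
  bsdp_two_of_analyticRank_le_one_of_conductor_lt_5000 hS31 curve243a1 hr.le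
    (lt_of_le_of_lt (Nat.le_of_dvd (by norm_num) conductorNorm_curve243a1_dvd) (by norm_num))

/-! ### Twists of `243a1`: CM, `2` inert -/

/-- **`j = 0` on every model of every quadratic twist of `243a1`.** [cite: SilvermanAEC2009, X.5 Cor. 5.4] -/
theorem j_eq_zero_of_smul_twist_curve243a1 {d : ℚ} (hd : d ≠ 0) {W : WeierstrassCurve ℚ} [W.IsElliptic]
    {C : VariableChange ℚ} (hC : C • curve243a1.quadraticTwist d = W) : W.j = 0 := by
  haveI := curve243a1.isElliptic_quadraticTwist hd
  subst hC
  rw [variableChange_j, j_quadraticTwist _ hd, curve243a1_j]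

/-- **Every model of every quadratic twist of `243a1` has CM** (`j = 0`). [cite: SilvermanAEC2009, Appendix C §11, Example 11.3.1] -/
theorem hasCM_of_smul_twist_curve243a1 {d : ℚ} (hd : d ≠ 0) {W : WeierstrassCurve ℚ} [W.IsElliptic]
    {C : VariableChange ℚ} (hC : C • curve243a1.quadraticTwist d = W) : W.HasCM :=
  hasCM_of_j_eq_zero _ (j_eq_zero_of_smul_twist_curve243a1 hd hC)

/-- **`2` is INERT in the CM field of every twist of `243a1`** (`K_CM = ℚ(√−3)`): the family lies in the
inert type of the corner at `2` (crux `InertTwoRankOneOfFacts` of route PrintCf2; p4's slices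
`WAllCornerFTwoInert*`). [cite: Cox2013, §5.B Prop. 5.16] -/
theorem cmInert_two_of_smul_twist_curve243a1 {d : ℚ} (hd : d ≠ 0) {W : WeierstrassCurve ℚ} [W.IsElliptic]
    {C : VariableChange ℚ} (hC : C • curve243a1.quadraticTwist d = W) : CMInert W 2 :=
  (cmInert_two_iff_of_hasCM (hasCM_of_smul_twist_curve243a1 hd hC)).2
    (Or.inl (by rw [j_eq_zero_of_smul_twist_curve243a1 hd hC]; simp [cmFieldDiscrOfJ]))

/-! ### The printed row unpacked; the analytic ranks of `243a1` and `243a1^{(−23)}` -/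

/-- **The printed Table-1 row, unpacked at the tree's `ℚ(√−23)`**: a parametrisation datum `Dt` of
`243a1`, Heegner datum `H` (level `N(E)`, discriminant `d_K = −23`), embedding, Heegner point `P ∈ E(K)`
and `j : K → ℚ₂` with Assumption (★), for `K = sqrtField (−23)` (the typer's model
`KrizLi2019.curve243a1` and this file's `curve243a1` are the same `[0,0,1,0,−1]`, definitionally).
[cite: KrizLi2019, §6 Table 1 (row 243a1) and Remark 6.3] -/
theorem exists_assumptionStar_curve243a1 (htab : KrizLi2019.table1_row243a1) :
    ∃ (Dt : ModularParametrizationData curve243a1 (curve243a1.conductorNorm ℤ))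
      (H : HeegnerDatum (curve243a1.conductorNorm ℤ) (NumberField.discr (sqrtField (-23))))
      (ι : sqrtField (-23) →+* ℂ) (P : (curve243a1.baseChange (sqrtField (-23))).toAffine.Point)
      (j : sqrtField (-23) →ₐ[ℚ] ℚ_[2]),
      WeierstrassCurve.Affine.Point.map ι.toRatAlgHom P = heegnerPointComplex Dt H ∧
        KrizLi2019.AssumptionStar curve243a1 Dt (sqrtField (-23)) P j := by
  obtain ⟨hIQ, hdisc⟩ := isImaginaryQuadratic_and_discr_sqrtField_neg_twentyThree
  obtain ⟨_, Dt, H, ι, P, j, hP, hstar⟩ := htab (sqrtField (-23)) hIQ hdisc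
  exact ⟨Dt, H, ι, P, j, hP, hstar⟩

/-- **`1 ≤ rank_ℤ 243a1(ℚ)` IN THE KERNEL**: the rational point `3·(1,−1) = (73/36, −703/216)` has `3 ∣ 36`,
so it has infinite order (kind `NL`, Silverman VII.3.4, tree `one_le_mordellWeilRank_of_dvd_den`).
[cite: SilvermanAEC2009, VII.3.4 and Thm. VIII.6.7] [cite: Cremona1997, Table 1 (243a1: r = 1, generator (1,0))] -/
theorem one_le_mordellWeilRank_curve243a1 : 1 ≤ curve243a1.mordellWeilRank :=
  one_le_mordellWeilRank_of_dvd_den curve243a1 3 le_rfl (x := 73 / 36) (y := -703 / 216)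
    (WeierstrassCurve.Affine.equation_iff_nonsingular.mp (by
      rw [WeierstrassCurve.Affine.equation_iff]; norm_num [curve243a1]))
    (by norm_num)

/-- **`ord_{s=1} L(243a1, s) ≠ 0`** granted the CM rank-zero row C8 (`hBF`, Burungale–Flach 2024) and
modularity (`hmod`): were it `0`, `L(E,1) ≠ 0` and Burungale–Flach's RANK clause would give
`rank_ℤ E(ℚ) = 0`, contradicting the point of infinite order. [cite: BurungaleFlach2024, Thm. 1.1 and Cor. 2] -/
theorem analyticRank_curve243a1_ne_zero (hBF : bsdTriple_of_hasCM_of_L_one_ne_zero)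
    (hmod : hasEntireLFunction_rat) : curve243a1.analyticRank ≠ 0 := by
  intro h0
  have hL : curve243a1.entireLFunction 1 ≠ 0 :=
    (curve243a1.analyticRank_eq_zero_iff_holds (hmod curve243a1)).mp h0
  have hr : curve243a1.analyticRank = curve243a1.mordellWeilRank := (hBF curve243a1 hasCM_curve243a1 hL).1
  have h1 := one_le_mordellWeilRank_curve243a1
  omega

/-- **Kriz–Li Thm 4.3 at `d = 1`** (`χ_1(−N) = 1` trivially): for globally minimal models `W₁` of
`243a1^{(1)}` and `W₀` of `243a1^{(−23)}`, `{r_an(W₁), r_an(W₀)} = {0, 1}` and `r_an(W₁) = r_an(243a1)`.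
[cite: KrizLi2019, Thm. 4.3 (FMS) = arXiv Thm. 3.3] -/
theorem analyticRank_dichotomy_curve243a1 (h33 : KrizLi2019.thm33_rank_twist)
    (htab : KrizLi2019.table1_row243a1) (W₁ W₀ : WeierstrassCurve ℚ) [W₁.IsElliptic] [W₁.IsGloballyMinimal]
    [W₀.IsElliptic] [W₀.IsGloballyMinimal]
    (hW₁ : ∃ C : VariableChange ℚ, C • curve243a1.quadraticTwist 1 = W₁)
    (hW₀ : ∃ C : VariableChange ℚ, C • curve243a1.quadraticTwist (-23) = W₀) :
    ((W₁.analyticRank = 1 ∧ W₀.analyticRank = 0) ∨ (W₁.analyticRank = 0 ∧ W₀.analyticRank = 1)) ∧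
      W₁.analyticRank = curve243a1.analyticRank := by
  obtain ⟨hIQ, hdisc⟩ := isImaginaryQuadratic_and_discr_sqrtField_neg_twentyThree
  obtain ⟨Dt, H, ι, P, j, hP, hstar⟩ := exists_assumptionStar_curve243a1 htab
  have hW₁' : ∃ C : VariableChange ℚ, C • W₁ = curve243a1.quadraticTwist ((1 : ℤ) : ℚ) := by
    push_cast; exact exists_smul_eq_comm.2 hW₁
  have hW₀' : ∃ C : VariableChange ℚ,
      C • W₀ = curve243a1.quadraticTwist ((1 * NumberField.discr (sqrtField (-23)) : ℤ) : ℚ) := by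
    rw [hdisc]; push_cast; exact exists_smul_eq_comm.2 hW₀
  obtain ⟨-, -, hor, hiff⟩ := h33 curve243a1 twoTorsion_curve243a1 (sqrtField (-23)) hIQ
    (satisfiesHeegnerHypothesis_curve243a1 hIQ.1 hdisc) Dt H ι P hP j hstar 1 (KrizLi2019.inN_one _ _)
    W₁ W₀ hW₁' hW₀'
  exact ⟨hor, hiff.2 (by rw [Int.sign_one, one_mul]; exact jacobiSym.one_right _)⟩

/-- **`ord_{s=1} L(243a1, s) = 1`** — the printed "rank one" entry of Table 1, here a THEOREM granted
Thm 4.3 (`h33`), the (★)-row (`htab`), Burungale–Flach (`hBF`) and modularity (`hmod`): Thm 4.3 gives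
`r_an ≤ 1`, the kernel point of infinite order with Burungale–Flach gives `r_an ≠ 0`.
[cite: KrizLi2019, Thm. 4.3 and §6 Table 1 ("rank one curves")] [cite: BurungaleFlach2024, Cor. 2]
[cite: Cremona1997, Table 1 (243a1)] -/
theorem analyticRank_curve243a1 (h33 : KrizLi2019.thm33_rank_twist) (htab : KrizLi2019.table1_row243a1)
    (hBF : bsdTriple_of_hasCM_of_L_one_ne_zero) (hmod : hasEntireLFunction_rat) :
    curve243a1.analyticRank = 1 := by
  obtain ⟨W₁, _, _, hW₁⟩ := P2.exists_globallyMinimal_twist curve243a1 (d := (1 : ℚ)) one_ne_zero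
  obtain ⟨W₀, _, _, hW₀⟩ := P2.exists_globallyMinimal_twist curve243a1 (d := (-23 : ℚ)) (by norm_num)
  obtain ⟨hor, heq⟩ := analyticRank_dichotomy_curve243a1 h33 htab W₁ W₀ hW₁ hW₀
  have hne := analyticRank_curve243a1_ne_zero hBF hmod
  omega

/-- **`ord_{s=1} L(243a1^{(−23)}, s) = 0`** on every globally minimal model (Thm 4.3 at `d = 1` and the
previous theorem). [cite: KrizLi2019, Thm. 4.3 (FMS) = arXiv Thm. 3.3] -/
theorem analyticRank_twist_neg23_curve243a1 (h33 : KrizLi2019.thm33_rank_twist)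
    (htab : KrizLi2019.table1_row243a1) (hBF : bsdTriple_of_hasCM_of_L_one_ne_zero)
    (hmod : hasEntireLFunction_rat) (W₀ : WeierstrassCurve ℚ) [W₀.IsElliptic] [W₀.IsGloballyMinimal]
    (hW₀ : ∃ C : VariableChange ℚ, C • curve243a1.quadraticTwist (-23) = W₀) : W₀.analyticRank = 0 := by
  obtain ⟨W₁, _, _, hW₁⟩ := P2.exists_globallyMinimal_twist curve243a1 (d := (1 : ℚ)) one_ne_zero
  obtain ⟨hor, heq⟩ := analyticRank_dichotomy_curve243a1 h33 htab W₁ W₀ hW₁ hW₀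
  have h1 := analyticRank_curve243a1 h33 htab hBF hmod
  omega

/-- **`BSD(243a1^{(−23)}, 2)`** — the SECOND certified base of the transport: `243a1^{(−23)}` has CM and
analytic rank `0` (Thm 4.3), so row C8 (Burungale–Flach 2024 Thm 1.1 + Cor 2 / Rubin 1991, tree fact
`bsdTriple_of_hasCM_of_L_one_ne_zero`, EVERY prime including `2`) applies — a 2024 theorem where the
paper says "by numerical verification" (conductor `243·23² = 128547 > 5000`).
[cite: BurungaleFlach2024, Thm. 1.1 and Cor. 2 (p. 4)] [cite: KrizLi2019, Thm. 4.3 and Rem. 5.2] -/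
theorem bsdp_two_twist_neg23_curve243a1 (h33 : KrizLi2019.thm33_rank_twist)
    (htab : KrizLi2019.table1_row243a1) (hBF : bsdTriple_of_hasCM_of_L_one_ne_zero)
    (hmod : hasEntireLFunction_rat) (W₀ : WeierstrassCurve ℚ) [W₀.IsElliptic] [W₀.IsGloballyMinimal]
    (hW₀ : ∃ C : VariableChange ℚ, C • curve243a1.quadraticTwist (-23) = W₀) : BSDp W₀ 2 := by
  obtain ⟨C, hC⟩ := hW₀
  exact RowC8.bsdp hBF hmod ⟨hasCM_of_smul_twist_curve243a1 (by norm_num) hC,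
    analyticRank_twist_neg23_curve243a1 h33 htab hBF hmod W₀ ⟨C, hC⟩⟩

/-! ## §8 The theorem: `BSD(2)` for the Kriz–Li twists `243a1^{(d)}`, `243a1^{(−23d)}`, `d ∈ 𝒩` -/

/-- `d ∈ 𝒩` is non-zero (`|d|` square-free). [folklore] -/
theorem ne_zero_of_inN {K : Type} [Field K] [NumberField K] {d : ℤ} (hd : KrizLi2019.InN curve243a1 K d) :
    (d : ℚ) ≠ 0 := by
  have h := hd.2.1.ne_zero
  exact_mod_cast (Int.natAbs_ne_zero.mp h)

/-- **`2`-PART OF BSD FOR THE KRIZ–LI TWISTS OF `243a1`.** Granted BY NAME Kriz–Li 2019 Thm 5.1 (2)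
(`hKL`) and Thm 4.3 (`h33`), the Table-1 row of `243a1` (`htab`: analytic rank one, Heegner point over
`ℚ(√−23)` with (★)), Creutz–Miller / Miller–Stoll (`hS31`: `BSD(243a1, 2)`), the CM rank-zero row C8
(`hBF`: `BSD(243a1^{(−23)}, 2)`) and modularity (`hmod`): for every `d ∈ 𝒩` (Def 4.1 at
`(243a1, ℚ(√−23))`) with `χ_d(−N) = 1` and EVERY globally minimal model `W` of `243a1^{(d)}` or of
`243a1^{(−23d)}`, `BSD(W, 2)` holds. The kernel supplies `E(ℚ)[2] = 0`, the Heegner hypothesis,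
`c₂ = 1`, good reduction at `2`, and both base cases from the named theorems.
[cite: KrizLi2019, Thm. 5.1 (2) (FMS, VoR p. 30) = arXiv:1606.03172 Thm. 1.12; Thm. 4.3; §6 Table 1 row 243a1, Rem. 6.3]
[cite: CreutzMiller2012, Thm. 1.1] [cite: BurungaleFlach2024, Thm. 1.1 and Cor. 2] [cite: Miller2011LMS, Def. 1.1] -/
theorem bsdp_two_of_twist_curve243a1 (hKL : KrizLi2019.thm112_bsdTwo_twist) (h33 : KrizLi2019.thm33_rank_twist)
    (htab : KrizLi2019.table1_row243a1) (hS31 : bsdTriple_of_analyticRank_le_one_of_conductor_lt)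
    (hBF : bsdTriple_of_hasCM_of_L_one_ne_zero) (hmod : hasEntireLFunction_rat)
    {d : ℤ} (hd : KrizLi2019.InN curve243a1 (sqrtField (-23)) d)
    (hsign : Int.sign d * jacobiSym (curve243a1.conductorNorm ℤ) d.natAbs = 1)
    (W : WeierstrassCurve ℚ) [W.IsElliptic] [W.IsGloballyMinimal]
    (hW : (∃ C : VariableChange ℚ, C • curve243a1.quadraticTwist (d : ℚ) = W) ∨
      (∃ C : VariableChange ℚ, C • curve243a1.quadraticTwist ((-23 * d : ℤ) : ℚ) = W)) :
    BSDp W 2 := by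
  obtain ⟨hIQ, hdisc⟩ := isImaginaryQuadratic_and_discr_sqrtField_neg_twentyThree
  obtain ⟨Dt, H, ι, P, j, hP, hstar⟩ := exists_assumptionStar_curve243a1 htab
  obtain ⟨W₀, _, _, hW₀⟩ := P2.exists_globallyMinimal_twist curve243a1 (d := (-23 : ℚ)) (by norm_num)
  have hbase : BSDp curve243a1 2 := bsdp_two_curve243a1 hS31 (analyticRank_curve243a1 h33 htab hBF hmod)
  have hbase₀ : BSDp W₀ 2 := bsdp_two_twist_neg23_curve243a1 h33 htab hBF hmod W₀ hW₀
  have hW₀' : ∃ C : VariableChange ℚ,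
      C • curve243a1.quadraticTwist (NumberField.discr (sqrtField (-23)) : ℚ) = W₀ := by
    rw [hdisc]; push_cast; exact hW₀
  have hd0 : (d : ℚ) ≠ 0 := ne_zero_of_inN hd
  have hdK : ((d * NumberField.discr (sqrtField (-23)) : ℤ) : ℚ) = ((-23 * d : ℤ) : ℚ) := by
    rw [hdisc]; push_cast; ring
  have hH := satisfiesHeegnerHypothesis_curve243a1 hIQ.1 hdisc
  rcases hW with hW | hW
  · obtain ⟨W₂, _, _, hW₂⟩ := P2.exists_globallyMinimal_twist curve243a1 (d := ((-23 * d : ℤ) : ℚ))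
      (by push_cast; exact mul_ne_zero (by norm_num) hd0)
    exact (P2.bsdp_two_twists_of_krizLi hKL twoTorsion_curve243a1 (sqrtField (-23)) hIQ hH Dt H ι P hP j
      hstar (krizLi_loc_curve243a1 Dt) hW₀' hbase hbase₀ d hd hsign (W₁ := W) (W₂ := W₂) hW
      (by rw [hdK]; exact hW₂)).1
  · obtain ⟨W₁, _, _, hW₁⟩ := P2.exists_globallyMinimal_twist curve243a1 (d := (d : ℚ)) hd0
    exact (P2.bsdp_two_twists_of_krizLi hKL twoTorsion_curve243a1 (sqrtField (-23)) hIQ hH Dt H ι P hP j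
      hstar (krizLi_loc_curve243a1 Dt) hW₀' hbase hbase₀ d hd hsign (W₁ := W₁) (W₂ := W) hW₁
      (by rw [hdK]; exact hW)).2

/-- **The analytic ranks of the twists** (Kriz–Li Thm 4.3): for `d ∈ 𝒩` with `χ_d(−N) = 1`, every
globally minimal model of `243a1^{(d)}` has analytic rank `1` (`= r_an(243a1)`) and every globally minimal
model of `243a1^{(−23d)}` has analytic rank `0` — so the rank-one members of the family are exactly the
`243a1^{(d)}`. [cite: KrizLi2019, Thm. 4.3 (FMS) = arXiv Thm. 3.3] -/
theorem analyticRank_of_twist_curve243a1 (h33 : KrizLi2019.thm33_rank_twist) (htab : KrizLi2019.table1_row243a1)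
    (hBF : bsdTriple_of_hasCM_of_L_one_ne_zero) (hmod : hasEntireLFunction_rat)
    {d : ℤ} (hd : KrizLi2019.InN curve243a1 (sqrtField (-23)) d)
    (hsign : Int.sign d * jacobiSym (curve243a1.conductorNorm ℤ) d.natAbs = 1)
    (W₁ W₂ : WeierstrassCurve ℚ) [W₁.IsElliptic] [W₁.IsGloballyMinimal] [W₂.IsElliptic] [W₂.IsGloballyMinimal]
    (hW₁ : ∃ C : VariableChange ℚ, C • curve243a1.quadraticTwist (d : ℚ) = W₁)
    (hW₂ : ∃ C : VariableChange ℚ, C • curve243a1.quadraticTwist ((-23 * d : ℤ) : ℚ) = W₂) :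
    W₁.analyticRank = 1 ∧ W₂.analyticRank = 0 := by
  obtain ⟨hIQ, hdisc⟩ := isImaginaryQuadratic_and_discr_sqrtField_neg_twentyThree
  obtain ⟨Dt, H, ι, P, j, hP, hstar⟩ := exists_assumptionStar_curve243a1 htab
  have hdK : ((d * NumberField.discr (sqrtField (-23)) : ℤ) : ℚ) = ((-23 * d : ℤ) : ℚ) := by
    rw [hdisc]; push_cast; ring
  obtain ⟨-, -, hor, hiff⟩ := h33 curve243a1 twoTorsion_curve243a1 (sqrtField (-23)) hIQ
    (satisfiesHeegnerHypothesis_curve243a1 hIQ.1 hdisc) Dt H ι P hP j hstar d hd W₁ W₂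
    (exists_smul_eq_comm.2 hW₁) (by rw [hdK]; exact exists_smul_eq_comm.2 hW₂)
  have h1 : W₁.analyticRank = 1 := by
    rw [← analyticRank_curve243a1 h33 htab hBF hmod]; exact hiff.2 hsign
  rcases hor with ⟨-, h0⟩ | ⟨h0, -⟩
  · exact ⟨h1, h0⟩
  · omega

/-! ## §9 Membership predicate of the family and the slice BY NAME -/

/-- **`W` is a `ℚ`-model of a Kriz–Li twist of `243a1`**: there are `d ∈ 𝒩` (Kriz–Li Def 4.1 at
`E = 243a1`, `K = ℚ(√−23)` = the tree's `sqrtField (−23)`: `d ≡ 1 (mod 4)`, `|d|` a square-free product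
of primes `ℓ ∤ 2N` split in `K` with `a_ℓ(E)` odd) with `χ_d(−N) = sgn(d)·(N/|d|) = 1`, and a
`ℚ`-isomorphism `C • 243a1^{(d)} = W` or `C • 243a1^{(−23d)} = W`. A definition with a body (data), not
a named fact. [cite: KrizLi2019, Def. 4.1 and Thm. 5.1 (2)] -/
def IsKrizLiTwoFortyThreeTwist (W : WeierstrassCurve ℚ) : Prop :=
  ∃ (d : ℤ) (C : VariableChange ℚ), KrizLi2019.InN curve243a1 (sqrtField (-23)) d ∧
    Int.sign d * jacobiSym (curve243a1.conductorNorm ℤ) d.natAbs = 1 ∧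
    (C • curve243a1.quadraticTwist (d : ℚ) = W ∨ C • curve243a1.quadraticTwist ((-23 * d : ℤ) : ℚ) = W)

/-- **EXPLICIT members**: `d > 0`, `d ≡ 1 (mod 12)`, `|d|` square-free, every prime `ℓ ∣ d` with
`ℓ ∉ {2,3}`, `(−23/ℓ) = 1` and `a_ℓ(243a1)` odd (`IsKrizLiPrime243`) — then `d ∈ 𝒩` and `χ_d(−N) = 1`
IN THE KERNEL, so every `ℚ`-model of `243a1^{(d)}` or `243a1^{(−23d)}` is in the family (e.g. `d = 13`,
`73`, `193`, `13·73`, …). [cite: KrizLi2019, Def. 4.1 and Thm. 5.1 (2)] -/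
theorem isKrizLiTwoFortyThreeTwist_of_explicit {d : ℤ} (hd0 : 0 < d) (hd12 : d % 12 = 1)
    (hsq : Squarefree d.natAbs) (hprimes : ∀ ℓ : ℕ, ℓ.Prime → ℓ ∣ d.natAbs → IsKrizLiPrime243 ℓ)
    {W : WeierstrassCurve ℚ} {C : VariableChange ℚ}
    (hC : C • curve243a1.quadraticTwist (d : ℚ) = W ∨ C • curve243a1.quadraticTwist ((-23 * d : ℤ) : ℚ) = W) :
    IsKrizLiTwoFortyThreeTwist W :=
  ⟨d, C, inN_curve243a1 (sqrtField.finrank_eq_two _) isImaginaryQuadratic_and_discr_sqrtField_neg_twentyThree.2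
    (by omega) hsq hprimes, sign_mul_jacobiSym_conductorNorm_curve243a1 hd0 hd12, hC⟩

/-- **`BSD(W, 2)` on the Kriz–Li family of `243a1`, ENTIRELY BY NAME** (no display binder).
[cite: KrizLi2019, Thm. 5.1 (2), Thm. 4.3, §6 Table 1 row 243a1] [cite: CreutzMiller2012, Thm. 1.1]
[cite: BurungaleFlach2024, Thm. 1.1 and Cor. 2] -/
theorem bsdp_two_of_isKrizLiTwoFortyThreeTwist (hKL : KrizLi2019.thm112_bsdTwo_twist) (h33 : KrizLi2019.thm33_rank_twist)
    (htab : KrizLi2019.table1_row243a1) (hS31 : bsdTriple_of_analyticRank_le_one_of_conductor_lt)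
    (hBF : bsdTriple_of_hasCM_of_L_one_ne_zero) (hmod : hasEntireLFunction_rat)
    (W : WeierstrassCurve ℚ) [W.IsElliptic] [W.IsGloballyMinimal] (hW : IsKrizLiTwoFortyThreeTwist W) :
    BSDp W 2 := by
  obtain ⟨d, C, hd, hsign, hC⟩ := hW
  exact bsdp_two_of_twist_curve243a1 hKL h33 htab hS31 hBF hmod hd hsign W
    (hC.imp (fun h => ⟨C, h⟩) (fun h => ⟨C, h⟩))

/-- **Placement**: every member of the family has CM with `2` inert in `K_CM = ℚ(√−3)` — it lies in the
inert type of the corner at `2` (crux `InertTwoRankOneOfFacts`), indeed in the Eisenstein-field half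
(`cmFieldDiscrOfJ W.j = −3`, the registered stub `stub_inert_eisensteinField`).
[cite: KrizLi2019, Rem. 6.3 ("j-invariant 0")] -/
theorem placement_of_isKrizLiTwoFortyThreeTwist (W : WeierstrassCurve ℚ) [W.IsElliptic] [W.IsGloballyMinimal]
    (hW : IsKrizLiTwoFortyThreeTwist W) : W.HasCM ∧ CMInert W 2 ∧ cmFieldDiscrOfJ W.j = -3 := by
  obtain ⟨d, C, hd, -, hC⟩ := hW
  have hd0 : (d : ℚ) ≠ 0 := ne_zero_of_inN hd
  rcases hC with hC | hC
  · exact ⟨hasCM_of_smul_twist_curve243a1 hd0 hC, cmInert_two_of_smul_twist_curve243a1 hd0 hC,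
      by rw [j_eq_zero_of_smul_twist_curve243a1 hd0 hC]; simp [cmFieldDiscrOfJ]⟩
  · have hd0' : (((-23 * d : ℤ)) : ℚ) ≠ 0 := by push_cast; exact mul_ne_zero (by norm_num) hd0
    exact ⟨hasCM_of_smul_twist_curve243a1 hd0' hC, cmInert_two_of_smul_twist_curve243a1 hd0' hC,
      by rw [j_eq_zero_of_smul_twist_curve243a1 hd0' hC]; simp [cmFieldDiscrOfJ]⟩

/-- **SLICE KL243 in LEAF SHAPE, BY NAME.** In the shape of the leaf `Summit.BirchSwinnertonDyer.WAllCornerFTwo`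
and of crux `InertTwoRankOneOfFacts` of route PrintCf2 (`∀ W, W.HasCM → W.analyticRank = 1 → CMInert W 2 →
… → BSDp W 2`; the three class hypotheses are not used): every globally minimal `ℚ`-model of a Kriz–Li
twist of `243a1` satisfies `BSD(W, 2)`, granted BY NAME Kriz–Li 2019 Thm 5.1 (2) (`hKL` ∈ 𝔅_inert) and
Thm 4.3 (`h33`), the Table-1 row `243a1` (`htab`), Creutz–Miller 2012 Thm 1.1 (`hS31`), Burungale–Flach
2024 (`hBF` ∈ 𝔅_inert) and modularity (`hmod` ∈ 𝔅_inert). Beyond print: YES as an assembly (the paper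
leaves `BSD(2)` of the rank-zero twin `243a1^{(−23)}`, conductor `128547`, to "numerical verification";
here it is Burungale–Flach 2024), NO as a method. [cite: KrizLi2019, Thm. 5.1 (2), Thm. 4.3, Example 6.2, Table 1, Rem. 6.3]
[cite: CreutzMiller2012, Thm. 1.1] [cite: BurungaleFlach2024, Thm. 1.1 and Cor. 2] -/
theorem cornerFTwo_krizLiTwoFortyThree_byName (hKL : KrizLi2019.thm112_bsdTwo_twist) (h33 : KrizLi2019.thm33_rank_twist)
    (htab : KrizLi2019.table1_row243a1) (hS31 : bsdTriple_of_analyticRank_le_one_of_conductor_lt)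
    (hBF : bsdTriple_of_hasCM_of_L_one_ne_zero) (hmod : hasEntireLFunction_rat) :
    ∀ (W : WeierstrassCurve ℚ) [W.IsElliptic] [W.IsGloballyMinimal], W.HasCM → W.analyticRank = 1 →
      CMInert W 2 → IsKrizLiTwoFortyThreeTwist W → BSDp W 2 :=
  fun W _ _ _ _ _ hW => bsdp_two_of_isKrizLiTwoFortyThreeTwist hKL h33 htab hS31 hBF hmod W hW

end Summit.BirchSwinnertonDyer.Rank1Residual.P2

end
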